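import Summits.CriticalPhenomena.CardyFormulaZ2.Theses.CardyMagicRigidity
import Literature.Probability.RandomPlanarGeometry.ModulusSymmetry
import Literature.Probability.RandomPlanarGeometry.CardyFunctionIncBeta

/-!
# Candidate proof of stub D3 `stub_cyclicFlip` of line `oracle-sandwich`
(crux `LoopsToCrossings`, stmt-CriticalPhenomena-4837) — refuter evidence, for the lead to land.

`R₂ = (Ω; P₁, P₂, P₃, P₀)`: boundary loop `u ↦ R.boundary (u + mark 1)`, marks
`(0, m₂ - m₁, m₃ - m₁, m₀ + 1 - m₁)`; a uniformizing datum `(φ, x)` of `R` has boundary values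
`R₂.pt` at the cyclically shifted tuple `(x₁, x₂, x₃, x₀)`, which the real Möbius map
`z ↦ c - 1/z`, `c ∈ (x₀, x₁)`, renormalises to a monotone datum of `R₂` with the same cross-ratio
`1 - η` (`crossRatio_cyclic`); datum independence (`crossRatio_eq_of_isUniformizing_holds`) and
`F(1 - η) = 1 - F(η)` (`cardyFunction_one_sub_holds`) finish.
-/

noncomputable section

namespace Summit.CriticalPhenomena.CardyFormulaZ2.Cruxes.LoopsToCrossings.DrefuteD3

open Literature.Probability.RandomPlanarGeometry Set Filter Topology
open UpperHalfPlane (upperHalfPlaneSet)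

/-- The cross-ratio of the cyclically shifted tuple `(x₁, x₂, x₃, x₀)` is `1 - crossRatio x`
(`(x₀-x₁)(x₂-x₃) + (x₀-x₃)(x₁-x₂) = (x₀-x₂)(x₁-x₃)`). [cite: AhlforsCA1979, Ch. 3 §3.1] -/
theorem crossRatio_cyclic (x : Fin 4 → ℝ) (h02 : x 0 ≠ x 2) (h13 : x 1 ≠ x 3) :
    crossRatio ![x 1, x 2, x 3, x 0] = 1 - crossRatio x := by
  have ha : x 0 - x 2 ≠ 0 := sub_ne_zero.2 h02
  have hb : x 1 - x 3 ≠ 0 := sub_ne_zero.2 h13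
  have hc : x 2 - x 0 ≠ 0 := sub_ne_zero.2 (Ne.symm h02)
  unfold crossRatio
  simp only [Matrix.cons_val_zero, Matrix.cons_val_one, Matrix.cons_val]
  field_simp
  ring

/-- **Möbius renormalisation, shifted pattern.** If `φ : ℍₒ → D` has boundary values the marked
points of the conformal rectangle `R` at real points `y i` in the cyclic pattern
`y₃ < y₀ < y₁ < y₂` or its reverse `y₂ < y₁ < y₀ < y₃` (the point `∞` between `y₂` and `y₃`), then
`z ↦ c - 1/z`, `c` strictly between `y₃` and `y₀`, renormalises it to a uniformizing datum with the
same cross-ratio. Same proof as `ConformalRectangle.exists_isUniformizing_of_cyclic` (which treats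
the patterns with `∞` between `y₀` and `y₁`). [cite: AhlforsCA1979, Ch. 3 §3.1] -/
theorem exists_isUniformizing_of_cyclic' (R : ConformalRectangle)
    (φ : ConformalEquiv upperHalfPlaneSet R.carrier) (y : Fin 4 → ℝ)
    (hbv : ∀ i, φ.HasBoundaryValue (y i) (R.pt i))
    (hy : (y 3 < y 0 ∧ y 0 < y 1 ∧ y 1 < y 2) ∨ (y 2 < y 1 ∧ y 1 < y 0 ∧ y 0 < y 3)) :
    ∃ (φ' : ConformalEquiv upperHalfPlaneSet R.carrier) (x : Fin 4 → ℝ),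
      R.IsUniformizing φ' x ∧ crossRatio x = crossRatio y := by
  set c : ℝ := (y 3 + y 0) / 2 with hc
  have hcy0 : c - y 0 ≠ 0 := by
    rcases hy with ⟨h1, h2, h3⟩ | ⟨h1, h2, h3⟩ <;> rw [hc] <;> intro h <;> linarith
  have hcy1 : c - y 1 ≠ 0 := by
    rcases hy with ⟨h1, h2, h3⟩ | ⟨h1, h2, h3⟩ <;> rw [hc] <;> intro h <;> linarith
  have hcy2 : c - y 2 ≠ 0 := by
    rcases hy with ⟨h1, h2, h3⟩ | ⟨h1, h2, h3⟩ <;> rw [hc] <;> intro h <;> linarith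
  have hcy3 : c - y 3 ≠ 0 := by
    rcases hy with ⟨h1, h2, h3⟩ | ⟨h1, h2, h3⟩ <;> rw [hc] <;> intro h <;> linarith
  have hcy : ∀ i, c - y i ≠ 0 := by
    intro i
    fin_cases i
    · exact hcy0
    · exact hcy1
    · exact hcy2
    · exact hcy3
  set x : Fin 4 → ℝ := fun i ↦ (c - y i)⁻¹ with hx
  have hx0 : ∀ i, x i ≠ 0 := fun i ↦ inv_ne_zero (hcy i)
  set φ' : ConformalEquiv upperHalfPlaneSet R.carrier := (ConformalEquiv.moebius (invShiftSL c)).trans φ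
  refine ⟨φ', x, ⟨?_, fun i ↦ ?_⟩, ?_⟩
  · rcases hy with ⟨h1, h2, h3⟩ | ⟨h1, h2, h3⟩
    · left
      have hc3 : 0 < c - y 3 := by rw [hc]; linarith
      have hc0 : c - y 0 < 0 := by rw [hc]; linarith
      have hc1 : c - y 1 < c - y 0 := by linarith
      have hc2 : c - y 2 < c - y 1 := by linarith
      refine Fin.strictMono_iff_lt_succ.2 fun i ↦ ?_
      fin_cases i
      · show (c - y 0)⁻¹ < (c - y 1)⁻¹
        exact (inv_lt_inv_of_neg hc0 (hc1.trans hc0)).2 hc1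
      · show (c - y 1)⁻¹ < (c - y 2)⁻¹
        exact (inv_lt_inv_of_neg (hc1.trans hc0) (hc2.trans (hc1.trans hc0))).2 hc2
      · show (c - y 2)⁻¹ < (c - y 3)⁻¹
        exact (inv_neg''.2 (hc2.trans (hc1.trans hc0))).trans (inv_pos.2 hc3)
    · right
      have hc3 : c - y 3 < 0 := by rw [hc]; linarith
      have hc0 : 0 < c - y 0 := by rw [hc]; linarith
      have hc1 : c - y 0 < c - y 1 := by linarith
      have hc2 : c - y 1 < c - y 2 := by linarith
      refine Fin.strictAnti_iff_succ_lt.2 fun i ↦ ?_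
      fin_cases i
      · show (c - y 1)⁻¹ < (c - y 0)⁻¹
        exact inv_strictAntiOn hc0 (hc0.trans hc1) hc1
      · show (c - y 2)⁻¹ < (c - y 1)⁻¹
        exact inv_strictAntiOn (hc0.trans hc1) ((hc0.trans hc1).trans hc2) hc2
      · show (c - y 3)⁻¹ < (c - y 2)⁻¹
        exact (inv_neg''.2 hc3).trans (inv_pos.2 ((hc0.trans hc1).trans hc2))
  · refine hasBoundaryValue_of_moebius (Φ := φ) (φ := φ') (g := invShiftSL c)
      (fun z _ ↦ rfl) (by simp [hx0 i]) ?_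
    have : ((invShiftSL c) 0 0 * x i + (invShiftSL c) 0 1) / ((invShiftSL c) 1 0 * x i +
        (invShiftSL c) 1 1) = y i := by
      simp only [invShiftSL_apply_00, invShiftSL_apply_01, invShiftSL_apply_10,
        invShiftSL_apply_11, one_mul, add_zero, hx]
      field_simp [hcy i]
      ring
    rw [this]
    exact hbv i
  · have h02 : c - y 0 ≠ c - y 2 := by
      rcases hy with ⟨h1, h2, h3⟩ | ⟨h1, h2, h3⟩ <;> intro h <;> linarith
    have h13 : c - y 1 ≠ c - y 3 := by
      rcases hy with ⟨h1, h2, h3⟩ | ⟨h1, h2, h3⟩ <;> intro h <;> linarith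
    rw [hx, crossRatio_inv (fun i ↦ c - y i) hcy h02 h13]
    have : (fun i ↦ c - y i) = fun i ↦ (-1) * y i + c := by ext i; ring
    rw [this, crossRatio_affine y (by norm_num) c]

/-- **The cyclically re-marked rectangle** `R₂ = (Ω; P₁, P₂, P₃, P₀)`: same carrier, boundary loop
re-based at `mark 1`, marks shifted by `-mark 1` (mod `1`). [folklore] -/
def shiftRect (R : ConformalRectangle) : ConformalRectangle where
  toJordanDomain :=
    { carrier := R.carrier
      boundary := fun u => R.boundary (u + R.mark 1)
      isOpen := R.isOpen
      isBounded := R.isBounded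
      isConnected := R.isConnected
      continuous_boundary := R.continuous_boundary.comp (continuous_id.add continuous_const)
      periodic_boundary := fun u => by
        show R.boundary (u + 1 + R.mark 1) = R.boundary (u + R.mark 1)
        rw [add_right_comm]
        exact R.periodic_boundary _
      injOn_boundary := by
        intro s hs t ht hst
        have hm := R.mark_mem 1
        have key : ∀ a ∈ Ico (0:ℝ) 1, ∃ a' ∈ Ico (0:ℝ) 1, R.boundary a' = R.boundary (a + R.mark 1) ∧
            (a' = a + R.mark 1 ∨ a' = a + R.mark 1 - 1) := by
          intro a ha
          by_cases h : a + R.mark 1 < 1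
          · exact ⟨a + R.mark 1, ⟨by linarith [ha.1, hm.1], h⟩, rfl, Or.inl rfl⟩
          · refine ⟨a + R.mark 1 - 1, ⟨by linarith, by linarith [ha.2, hm.2]⟩, ?_, Or.inr rfl⟩
            have := R.periodic_boundary (a + R.mark 1 - 1)
            rw [sub_add_cancel] at this
            exact this.symm
        obtain ⟨s', hs', hbs, hs'eq⟩ := key s hs
        obtain ⟨t', ht', hbt, ht'eq⟩ := key t ht
        have hst' : s' = t' := R.injOn_boundary hs' ht' (by rw [hbs, hbt]; exact hst)
        rcases hs'eq with rfl | rfl <;> rcases ht'eq with h | h <;> linarith [hs.1, hs.2, ht.1, ht.2]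
      range_boundary := by
        rw [← R.range_boundary]
        ext z
        simp only [mem_range]
        constructor
        · rintro ⟨u, rfl⟩; exact ⟨u + R.mark 1, rfl⟩
        · rintro ⟨u, rfl⟩; exact ⟨u - R.mark 1, by rw [sub_add_cancel]⟩ }
  mark := ![0, R.mark 2 - R.mark 1, R.mark 3 - R.mark 1, R.mark 0 + 1 - R.mark 1]
  strictMono_mark := by
    have h0 := (R.mark_mem 0).1
    have h01 : R.mark 0 < R.mark 1 := R.strictMono_mark (by decide)
    have h12 : R.mark 1 < R.mark 2 := R.strictMono_mark (by decide)
    have h23 : R.mark 2 < R.mark 3 := R.strictMono_mark (by decide)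
    have h3 := (R.mark_mem 3).2
    refine Fin.strictMono_iff_lt_succ.2 fun k ↦ ?_
    fin_cases k <;> simp <;> linarith
  mark_mem k := by
    have h0 := (R.mark_mem 0).1
    have h01 : R.mark 0 < R.mark 1 := R.strictMono_mark (by decide)
    have h12 : R.mark 1 < R.mark 2 := R.strictMono_mark (by decide)
    have h23 : R.mark 2 < R.mark 3 := R.strictMono_mark (by decide)
    have h3 := (R.mark_mem 3).2
    fin_cases k <;> simp <;> constructor <;> linarith

theorem shiftRect_carrier (R : ConformalRectangle) : (shiftRect R).carrier = R.carrier := rfl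
theorem shiftRect_boundary (R : ConformalRectangle) (u : ℝ) :
    (shiftRect R).boundary u = R.boundary (u + R.mark 1) := rfl
theorem shiftRect_mark (R : ConformalRectangle) (i : Fin 4) :
    (shiftRect R).mark i = ![0, R.mark 2 - R.mark 1, R.mark 3 - R.mark 1, R.mark 0 + 1 - R.mark 1] i := rfl

theorem shiftRect_pt_zero (R : ConformalRectangle) : (shiftRect R).pt 0 = R.pt 1 := by
  have h : (shiftRect R).pt 0 = R.boundary (0 + R.mark 1) := rfl
  rw [h, zero_add]
  rfl
theorem shiftRect_pt_one (R : ConformalRectangle) : (shiftRect R).pt 1 = R.pt 2 := by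
  have h : (shiftRect R).pt 1 = R.boundary ((R.mark 2 - R.mark 1) + R.mark 1) := rfl
  rw [h, sub_add_cancel]
  rfl
theorem shiftRect_pt_two (R : ConformalRectangle) : (shiftRect R).pt 2 = R.pt 3 := by
  have h : (shiftRect R).pt 2 = R.boundary ((R.mark 3 - R.mark 1) + R.mark 1) := rfl
  rw [h, sub_add_cancel]
  rfl
theorem shiftRect_pt_three (R : ConformalRectangle) : (shiftRect R).pt 3 = R.pt 0 := by
  have h : (shiftRect R).pt 3 = R.boundary ((R.mark 0 + 1 - R.mark 1) + R.mark 1) := rfl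
  rw [h, sub_add_cancel]
  exact R.periodic_boundary _

/-- **Stub D3 (`stub_cyclicFlip`) — candidate proof.** [cite: AhlforsCA1979, Ch. 3 §3.1 and Ch. 6 §1.1] -/
theorem stub_cyclicFlip_proof :
    ∀ R : ConformalRectangle, ∃ R₂ : ConformalRectangle, R₂.carrier = R.carrier ∧
      (∀ u : ℝ, R₂.boundary u = R.boundary (u + R.mark 1)) ∧
      (∀ i : Fin 4, R₂.mark i = ![0, R.mark 2 - R.mark 1, R.mark 3 - R.mark 1, R.mark 0 + 1 - R.mark 1] i) ∧
      ∀ (φ : ConformalEquiv UpperHalfPlane.upperHalfPlaneSet R.carrier) (x : Fin 4 → ℝ)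
        (φ₂ : ConformalEquiv UpperHalfPlane.upperHalfPlaneSet R₂.carrier) (x₂ : Fin 4 → ℝ),
        R.IsUniformizing φ x → R₂.IsUniformizing φ₂ x₂ →
        Literature.Probability.RandomPlanarGeometry.cardyFunction (crossRatio x₂) =
          1 - Literature.Probability.RandomPlanarGeometry.cardyFunction (crossRatio x) := by
  intro R
  refine ⟨shiftRect R, rfl, fun u => rfl, fun i => rfl, ?_⟩
  intro φ x φ₂ x₂ hux hux₂
  -- `φ` as a conformal map onto `(shiftRect R).carrier = R.carrier`, boundary values at the shifted tuple
  set y : Fin 4 → ℝ := ![x 1, x 2, x 3, x 0] with hy_def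
  have hbv : ∀ i, (φ : ConformalEquiv upperHalfPlaneSet (shiftRect R).carrier).HasBoundaryValue (y i)
      ((shiftRect R).pt i) := by
    intro i
    fin_cases i
    · simpa [hy_def, shiftRect_pt_zero] using hux.2 1
    · simpa [hy_def, shiftRect_pt_one] using hux.2 2
    · simpa [hy_def, shiftRect_pt_two] using hux.2 3
    · simpa [hy_def, shiftRect_pt_three] using hux.2 0
  have hy : (y 3 < y 0 ∧ y 0 < y 1 ∧ y 1 < y 2) ∨ (y 2 < y 1 ∧ y 1 < y 0 ∧ y 0 < y 3) := by
    rcases hux.1 with h | h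
    · left
      exact ⟨h (show (0 : Fin 4) < 1 by decide), h (show (1 : Fin 4) < 2 by decide),
        h (show (2 : Fin 4) < 3 by decide)⟩
    · right
      exact ⟨h (show (2 : Fin 4) < 3 by decide), h (show (1 : Fin 4) < 2 by decide),
        h (show (0 : Fin 4) < 1 by decide)⟩
  obtain ⟨φ', x', hux', hcr⟩ := exists_isUniformizing_of_cyclic' (shiftRect R) φ y hbv hy
  have hinj := hux.injective
  have h02 : x 0 ≠ x 2 := fun h => absurd (hinj h) (by decide)
  have h13 : x 1 ≠ x 3 := fun h => absurd (hinj h) (by decide)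
  have h1 : crossRatio x₂ = crossRatio x' := ConformalRectangle.crossRatio_eq_of_isUniformizing_holds hux₂ hux'
  have h2 : crossRatio y = 1 - crossRatio x := crossRatio_cyclic x h02 h13
  rw [h1, hcr, h2]
  exact cardyFunction_one_sub_holds (Ioo_subset_Icc_self (crossRatio_mem_Ioo hux.1))

/-- The registered stub, by name-shape (same statement as `OracleSandwich.stub_cyclicFlip`). -/
example : ∀ R : ConformalRectangle, ∃ R₂ : ConformalRectangle, R₂.carrier = R.carrier ∧
      (∀ u : ℝ, R₂.boundary u = R.boundary (u + R.mark 1)) ∧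
      (∀ i : Fin 4, R₂.mark i = ![0, R.mark 2 - R.mark 1, R.mark 3 - R.mark 1, R.mark 0 + 1 - R.mark 1] i) ∧
      ∀ (φ : ConformalEquiv UpperHalfPlane.upperHalfPlaneSet R.carrier) (x : Fin 4 → ℝ)
        (φ₂ : ConformalEquiv UpperHalfPlane.upperHalfPlaneSet R₂.carrier) (x₂ : Fin 4 → ℝ),
        R.IsUniformizing φ x → R₂.IsUniformizing φ₂ x₂ →
        Literature.Probability.RandomPlanarGeometry.cardyFunction (crossRatio x₂) =
          1 - Literature.Probability.RandomPlanarGeometry.cardyFunction (crossRatio x) :=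
  stub_cyclicFlip_proof

end Summit.CriticalPhenomena.CardyFormulaZ2.Cruxes.LoopsToCrossings.DrefuteD3

end
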